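import Summits.QuantumFields.YangMills.Theorems.UnitScaleTiltProp7AvgTrueLinearisation
import Summits.QuantumFields.YangMills.Theorems.UnitScaleTiltProp7TrueLinDefectBound
import Summits.QuantumFields.YangMills.Theorems.UnitScaleTiltProp7CurvedLandauKnitT3
import Summits.QuantumFields.YangMills.Theorems.UnitScaleTiltProp8ChartBridge
import HarnessLib

/-!
# Route `UnitScaleTilt`, crux K1 «MinimiserStabilityRegPr» (stmt-QuantumFields-19200), route-R E′ (A′) P-A2 F3″-C — THE COMPETITOR'S (0.4) GUARD
# AT EVERY LEVEL FROM THE PER-LEVEL TWO-BLOCK SUPS: `∀ i < K − n, ∀ c, Small ℰ_{SU(2)} (W̄^{(i)}) c`, and the pinning `emlIterU i W♭ = (W̄^{(i)})♭`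

Cell `ym3-torus` (HUMAN RULING D-0037, YM ladder rung R3 — continuum SU(2) YM₃ on T³ is a RUNG, not the Clay problem), width seat `ym3-torus-px22` gen 4.
`--supports stmt-QuantumFields-19200 --as helper`; THEOREMS ONLY (0 `def`, 0 `sorry`, standard axioms); count-neutral.

WHY.  The T³ knit of the twisted level masses (P-A2 F3″-C; px22 g3 LOCATE v2 §5, px17 g3 LOCATE cfa33860) reads the generic accumulated-frame step
(✓ `Prop7FrameMassStep.frameMass_step_le`, `𝔸ˣ`-valued towers `emlIterU k U₀♭`, `emlIterU k W♭`) on the `SU(2)` towers of the (n3) row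
✓ `Prop7FibreLevelMassPerLevelT3.sum_normSq_levelRatio_le_LOnly_T3` (`Averaging.iter (blockAvg ℰ_{SU(2)}) k U₀`, `… k W`).  The bridge between the two is
✓ `Prop8Chart.coe_emlIterU_unitsField`, whose ONLY hypothesis is the (0.4) guard at every level, `∀ i < k, ∀ c, Small ℰ (Ū^{(i)}) c`.  For the BACKGROUND `U₀`
the guard is ✓ `Prop8ChartAllL.small_iter_T3_allL` (plaquette smallness); the COMPETITOR `W` is not plaquette-small in the knit's currency, and px17 g3's
LOCATE (V4) lists its guard «(GW)» as the one displayed hypothesis of the T³ theorem beyond (n3)'s binders, «derivable from `hμ` + U₀'s loop sizes as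
lit `BlockAveragingEMLLinearisedBackground` :566 does inline».  This file is that derivation, exported once: the competitor's loop variables at `c` are
`W(Γᵢ) = [W(Γᵢ)Ū₀(Γᵢ)*]·Ū₀(Γᵢ)` with `‖W(Γᵢ)Ū₀(Γᵢ)* − 1‖ ≤ Π_{s∈Γᵢ}(1 + ‖Y_{b(s)}‖) − 1 ≤ 2·Σ_{s∈Γᵢ}‖Y_{b(s)}‖` (✓ `Prop7HolRatioPerStep.norm_holRatio_bounds_perStep`,
no uniform sup) and `‖Ū₀(Γᵢ) − 1‖ ≤ α`, so `dist1 (W(Γᵢ)) ≤ 2m + α < δ_N` whenever the walk masses are `≤ m ≤ 1`.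

WHAT IS PROVED (ns `…Theorems.Prop7CompetitorGuardOfLevelSups`):
* §1 `small_of_walkSums` — generic `SU(N)`, any torus `P`, any level `j`: walk masses `≤ m ≤ 1`, background loops `≤ α`, `2m + α < δ_N` ⟹ `Small ℰ U c`.
* §2 `small_of_twoBlockMass` — the same from the two-block mass `(d+2)L·Σ_{b : blockOf b₋ ∈ {c₋,c₊}}‖Y b‖ ≤ m` (✓ `Prop7TrueLinDefectBound.mass_loop_le`).
* §3 ★★ `small_iter_competitor_T3` — at the d = 3 carrier, under (n3) ✓ `sum_normSq_levelRatio_le_LOnly_T3`'s binders `hε hεL hU μ hμ0 hμ hμ72 hμN` VERBATIM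
  (no `θ`-rows): `∀ i, i < K − n → ∀ c, Small (expMeanLogSU (n := Fin 2)) (Averaging.iter (blockAvg ℰ) i W) c` — the `hsmall` hypothesis of
  ✓ `Prop8Chart.coe_emlIterU_unitsField W (K − n)` token for token.
* §4 ★★ `coe_emlIterU_unitsField_competitor_T3` — the pinning for the competitor: `∀ i ≤ K − n, ∀ b, ↑(emlIterU i (unitsField (toUField W)) b) = ↑(W̄^{(i)} b)`,
  and `small_iter_background_T3'` ∕ `coe_emlIterU_unitsField_background_T3'` — the background's twins under the SAME (n3) binders (so a consumer needs no
  second smallness letter `10⁷L³ε ≤ 1`).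

HONEST SCOPE: bookkeeping over landed theorems (one triangle inequality per loop); constants are (n3)'s.  No definition, no sorry, standard axioms.  Nothing of
F3″-C, P-A2, `hcoW`∕`hcoS`, E′, EX, the crux, the rung or the mass gap is claimed.

References: T. Bałaban, CMP **98** (1985) 17–51 [Balaban1985Averaging] ((122)–(123) p.36, Prop. 2 (53) p.26); CMP **109** (1987) 249–301 [Balaban1987RG1]
((0.3)–(0.4) pp.252–253); CMP **102** (1985) 277–309 [Balaban1985Variational] ((14)–(15) p.280, Prop. 7 p.299).
-/

set_option autoImplicit false

noncomputable section

open scoped BigOperators Matrix.Norms.L2Operator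

namespace Summit.QuantumFields.YangMills.Theorems.Prop7CompetitorGuardOfLevelSups

open Literature.MathematicalPhysics.QuantumFieldTheory.Balaban1983to89
open Literature.MathematicalPhysics.QuantumFieldTheory.Balaban1983to89.T3ContinuumYM3Torus
open Finset T4Continuum BlockAveraging AveragingRT ExpMeanLog BlockAveragingEMLLinearised BlockAveragingEMLLinearisedBackground
open B10Eq27TorusAxialLog (unitsField toUField)
open Summit.QuantumFields.YangMills.Theorems.Prop7HolRatioPerStep (norm_holRatio_bounds_perStep norm_coe_eq_one coe_star_mul_self
  list_prod_one_add_sub_one_le_two_mul)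
open Summit.QuantumFields.YangMills.Theorems.Prop7TrueLinDefectBound (mass_loop_le)
open Summit.QuantumFields.YangMills.Theorems.Prop7CovIterLambdaBound (plaqSmall_of_le_of_lt)
open Summit.QuantumFields.YangMills.Theorems.Prop7CurvedLandauRowE (loop_size_geom size_numerals)
open Summit.QuantumFields.YangMills.Theorems.Prop7CurvedLandauKnitT3 (smallness_T3 three_le_L)
open Summit.QuantumFields.YangMills.Theorems.Prop8Chart (emlIterU coe_emlIterU_unitsField)

/-! ## §1 Generic: the guard from walk masses -/

section Generic

variable {n : Type*} [Fintype n] [DecidableEq n] [Nonempty n] {P : Params} {j : ℕ}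

/-- **THE COMPETITOR'S (0.4) GUARD FROM THE WALK MASSES** (`SU(N)`, any torus, any level): if along every (0.4) loop walk at `c` the mass of
`Y = pertVar U₀ U` is `≤ m ≤ 1`, the background's loop variables at `c` are within `α` of `1`, and `2m + α < δ_N`, then every loop variable of `U` at `c`
is `δ_N`-small: `U(Γᵢ) − 1 = (U(Γᵢ)U₀(Γᵢ)* − 1)·U₀(Γᵢ) + (U₀(Γᵢ) − 1)` with `‖U(Γᵢ)U₀(Γᵢ)* − 1‖ ≤ Π(1+‖Y‖) − 1 ≤ 2m`.
[cite: Balaban1985Averaging, (122)-(123) p.36; Balaban1987RG1, (0.4) p.253] -/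
theorem small_of_walkSums (U₀ U : GaugeField P j (Matrix.specialUnitaryGroup n ℂ)) (c : PBond P (j + 1)) {m α : ℝ}
    (hmL : ∀ i : Idx P, ((walk (emb c.src) (loopWord P.L c.dir (off i.1) i.2.1 i.2.2)).map fun s => ‖pertVar U₀ U s.bond‖).sum ≤ m)
    (hm1 : m ≤ 1) (hα : ∀ i, dist1 (loopHol U₀ c i) ≤ α) (hN : 2 * m + α < deltaSU n) :
    Small (expMeanLogSU (n := n)) U c := by
  intro i
  -- letters: the two loop variables read in `M_N(ℂ)`
  set W : Matrix n n ℂ := ((loopHol U c i : Matrix.specialUnitaryGroup n ℂ) : Matrix n n ℂ) with hW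
  set W₀ : Matrix n n ℂ := ((loopHol U₀ c i : Matrix.specialUnitaryGroup n ℂ) : Matrix n n ℂ) with hW₀
  -- the relative loop variable from the per-step bounds
  have hs1 : ((walk (emb c.src) (loopWord P.L c.dir (off i.1) i.2.1 i.2.2)).map fun s => ‖pertVar U₀ U s.bond‖).sum ≤ 1 := (hmL i).trans hm1
  have hratio : ‖W * star W₀ - 1‖ ≤ 2 * m := by
    have h := (norm_holRatio_bounds_perStep U₀ U (walk (emb c.src) (loopWord P.L c.dir (off i.1) i.2.1 i.2.2))).1
    have h3 := list_prod_one_add_sub_one_le_two_mul (fun s : LStep P j => ‖pertVar U₀ U s.bond‖) (fun _ => norm_nonneg _) _ hs1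
    exact h.trans (h3.trans (by linarith [hmL i]))
  -- unitarity and size of the background loop variable
  have hW₀u : star W₀ * W₀ = 1 := coe_star_mul_self _
  have hW₀1 : ‖W₀ - 1‖ ≤ α := by rw [hW₀, ← FederbushMean.dist1_SU_eq]; exact hα i
  have hW₀n : ‖W₀‖ = 1 := norm_coe_eq_one _
  -- the triangle inequality
  show dist1 (loopHol U c i) < (expMeanLogSU (n := n)).δ
  rw [expMeanLogSU_δ, FederbushMean.dist1_SU_eq]
  have e : W - 1 = (W * star W₀ - 1) * W₀ + (W₀ - 1) := by
    rw [sub_mul, mul_assoc, hW₀u, mul_one, one_mul]; abel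
  rw [← hW, e]
  calc ‖(W * star W₀ - 1) * W₀ + (W₀ - 1)‖ ≤ ‖W * star W₀ - 1‖ * ‖W₀‖ + ‖W₀ - 1‖ :=
        (norm_add_le _ _).trans (add_le_add (norm_mul_le _ _) le_rfl)
    _ ≤ 2 * m * 1 + α := by rw [hW₀n]; exact add_le_add (mul_le_mul_of_nonneg_right hratio zero_le_one) hW₀1
    _ < deltaSU n := by linarith

/-! ## §2 Generic: the guard from the two-block mass -/

/-- **THE COMPETITOR'S (0.4) GUARD FROM THE TWO-BLOCK MASS**: if `(d+2)L·Σ_{b : blockOf b₋ ∈ {c₋, c₊}}‖Y b‖ ≤ m ≤ 1` (`Y = pertVar U₀ U`), the background's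
loop variables at `c` are within `α` of `1`, and `2m + α < δ_N`, then `Small ℰ U c` (every (0.4) loop walk at `c` has `≤ (d+2)L` steps, all issuing from
`B(c₋) ∪ B(c₊)`: ✓ `mass_loop_le`). [cite: Balaban1987RG1, (0.3)-(0.4) pp.252-253; Balaban1985Averaging, (122)-(123) p.36] -/
theorem small_of_twoBlockMass (hj : j + 1 ≤ P.m + P.K) (U₀ U : GaugeField P j (Matrix.specialUnitaryGroup n ℂ)) (c : PBond P (j + 1)) {m α : ℝ}
    (hm : (((P.d + 2) * P.L : ℕ) : ℝ) * ∑ b ∈ univ.filter (fun b : PBond P j => blockOf b.src = c.src ∨ blockOf b.src = c.tgt), ‖pertVar U₀ U b‖ ≤ m)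
    (hm1 : m ≤ 1) (hα : ∀ i, dist1 (loopHol U₀ c i) ≤ α) (hN : 2 * m + α < deltaSU n) :
    Small (expMeanLogSU (n := n)) U c :=
  small_of_walkSums U₀ U c (fun i => (mass_loop_le hj (pertVar U₀ U) c i).trans hm) hm1 hα hN

end Generic

/-! ## §3 The d = 3 carrier: the competitor's guard at every level under (n3)'s binders -/

section T3

/-- **U₀'S LOOP SIZES AT EVERY LEVEL UNDER (n3)'S BINDERS** (`0 < ε`, `10⁶L⁵ε ≤ 1`, `dist1(U₀(∂p)) ≤ ε·ℓ⁻²`, `ℓ = L^{K−n}`): for `j < K − n` every (0.4) loop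
variable of `Ū₀^{(j)}` is within `((d+2)L)²·ε ≤ 1∕24` of `1` (the tower term of ✓ `Prop7FibreLevelMassT3` :124–:131, exported).
[cite: Balaban1985Averaging, Prop. 2 (53) p.26; Balaban1987RG1, (0.4) p.253] -/
theorem loop_size_background_T3 (F : T3Family) (n K : ℕ)
    (U₀ : GaugeField (F.P K) 0 (Matrix.specialUnitaryGroup (Fin 2) ℂ)) {ε : ℝ} (hε : 0 < ε) (hεL : 1000000 * (F.L : ℝ) ^ 5 * ε ≤ 1)
    (hU : ∀ p : Plaq (F.P K) 0, dist1 (GaugeField.plaqHol U₀ p) ≤ ε * (((F.L : ℝ) ^ (K - n)) ^ 2)⁻¹) :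
    ∀ j < K - n, ∀ (c : PBond (F.P K) (j + 1)) (i : Idx (F.P K)),
      dist1 (loopHol (Averaging.iter (fun i => blockAvg (P := (F.P K)) (j := i) (expMeanLogSU (n := Fin 2))) j U₀) c i)
          ≤ ((((F.P K).d + 2) * (F.P K).L : ℕ) : ℝ) ^ 2 / 2 * (2 * ε) ∧
        ((((F.P K).d + 2) * (F.P K).L : ℕ) : ℝ) ^ 2 / 2 * (2 * ε) ≤ 1 / 24 := by
  have hLF : (F.P K).L = F.L := rfl
  have hL3 := three_le_L F
  have hLpos : (0 : ℝ) < (F.L : ℝ) := by linarith only [hL3]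
  obtain ⟨-, hε3, hε2, hε24, -⟩ := smallness_T3 F K hε hεL
  have hε' : 0 < 2 * ε := by linarith only [hε]
  have hU' : PlaqSmall (2 * ε * ((((F.P K).L : ℝ) ^ (K - n))⁻¹) ^ 2) U₀ := by
    refine plaqSmall_of_le_of_lt hU ?_
    rw [hLF, inv_pow]
    exact mul_lt_mul_of_pos_right (by linarith only [hε]) (inv_pos.mpr (by positivity))
  have hα := loop_size_geom (N := 2) (K - n) hε' hε3 hε2 hU'
  obtain ⟨hale, h24, -⟩ := size_numerals (N := 2) (K - n) hε' hε2 hε24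
  intro j hj c i
  exact ⟨(hα j hj c i).trans (hale j hj), h24⟩

/-- ★★ **THE COMPETITOR'S (0.4) GUARD AT EVERY LEVEL, d = 3, `SU(2)`, UNDER (n3)'S BINDERS VERBATIM** (✓ `sum_normSq_levelRatio_le_LOnly_T3` :277–:281, no
`θ`-rows): `U₀, W` on the finest torus of run `K`; `dist1(U₀(∂p)) ≤ εℓ⁻²` (`0 < ε`, `10⁶L⁵ε ≤ 1`); per-level bounds `μ_j` of the two-block masses
`(d+2)L·Σ_{b∈N(c)}‖Y_j(b)‖` (`0 ≤ μ_j`, `72μ_j ≤ 1`, `3μ_j + 1∕24 < δ₂`).  THEN every iterated average `W̄^{(i)}`, `i < K − n`, satisfies the (0.4) guard at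
every coarse bond — the `hsmall` hypothesis of ✓ `Prop8Chart.coe_emlIterU_unitsField W (K − n)` token for token.
[cite: Balaban1987RG1, (0.4) p.253; Balaban1985Averaging, (122)-(123) p.36, Prop. 2 (53) p.26] -/
theorem small_iter_competitor_T3 (F : T3Family) (n K : ℕ)
    (U₀ W : GaugeField (F.P K) 0 (Matrix.specialUnitaryGroup (Fin 2) ℂ)) {ε : ℝ} (hε : 0 < ε) (hεL : 1000000 * (F.L : ℝ) ^ 5 * ε ≤ 1)
    (hU : ∀ p : Plaq (F.P K) 0, dist1 (GaugeField.plaqHol U₀ p) ≤ ε * (((F.L : ℝ) ^ (K - n)) ^ 2)⁻¹)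
    (μ : ℕ → ℝ) (hμ0 : ∀ j < K - n, 0 ≤ μ j)
    (hμ : ∀ j < K - n, ∀ c : PBond (F.P K) (j + 1), ((((F.P K).d + 2) * (F.P K).L : ℕ) : ℝ) * ∑ b ∈ (univ.filter (fun b : PBond (F.P K) j => blockOf b.src = c.src ∨ blockOf b.src = c.tgt)), ‖(pertVar (Averaging.iter (fun i => blockAvg (P := (F.P K)) (j := i) (expMeanLogSU (n := Fin 2))) j U₀) (Averaging.iter (fun i => blockAvg (P := (F.P K)) (j := i) (expMeanLogSU (n := Fin 2))) j W)) b‖ ≤ μ j)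
    (hμ72 : ∀ j < K - n, 72 * μ j ≤ 1) (hμN : ∀ j < K - n, 3 * μ j + 1 / 24 < deltaSU (Fin 2)) :
    ∀ i, i < K - n → ∀ c : PBond (F.P K) (i + 1),
      Small (expMeanLogSU (n := Fin 2)) (Averaging.iter (fun j => blockAvg (P := F.P K) (j := j) (expMeanLogSU (n := Fin 2))) i W) c := by
  intro i hi c
  have hk : i + 1 ≤ (F.P K).m + (F.P K).K := by show i + 1 ≤ F.m + K; omega
  have hαi := loop_size_background_T3 F n K U₀ hε hεL hU i hi c
  refine small_of_twoBlockMass hk _ _ c (hμ i hi c) (by linarith only [hμ72 i hi]) (fun idx => (hαi idx).1) ?_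
  have h24 := (hαi (Classical.arbitrary _)).2
  linarith only [hμN i hi, hμ0 i hi, h24]

/-- **THE BACKGROUND'S (0.4) GUARD AT EVERY LEVEL UNDER THE SAME (n3) BINDERS** (twin of ✓ `Prop8ChartAllL.small_iter_T3_allL`, which is stated under
`10⁷L³ε₀ ≤ 1` ∕ `regThreshold`; here under (n3)'s `10⁶L⁵ε ≤ 1` ∕ `ε·(ℓ²)⁻¹`, so that a consumer of (n3)'s row needs no second smallness letter):
`α_j ≤ 1∕24 < 1∕3 = δ₂`. [cite: Balaban1987RG1, (0.4) p.253; Balaban1985Averaging, Prop. 2 (53) p.26] -/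
theorem small_iter_background_T3' (F : T3Family) (n K : ℕ)
    (U₀ : GaugeField (F.P K) 0 (Matrix.specialUnitaryGroup (Fin 2) ℂ)) {ε : ℝ} (hε : 0 < ε) (hεL : 1000000 * (F.L : ℝ) ^ 5 * ε ≤ 1)
    (hU : ∀ p : Plaq (F.P K) 0, dist1 (GaugeField.plaqHol U₀ p) ≤ ε * (((F.L : ℝ) ^ (K - n)) ^ 2)⁻¹) :
    ∀ i, i < K - n → ∀ c : PBond (F.P K) (i + 1),
      Small (expMeanLogSU (n := Fin 2)) (Averaging.iter (fun j => blockAvg (P := F.P K) (j := j) (expMeanLogSU (n := Fin 2))) i U₀) c := by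
  intro i hi c idx
  have h := loop_size_background_T3 F n K U₀ hε hεL hU i hi c idx
  show dist1 _ < (expMeanLogSU (n := Fin 2)).δ
  rw [expMeanLogSU_δ]
  have hδ : (1 : ℝ) / 24 < deltaSU (Fin 2) := by
    rw [deltaSU, Fintype.card_fin]
    have hπ : (1 : ℝ) / 24 < Real.pi / 2 := by linarith only [Real.pi_gt_three]
    exact lt_min (by norm_num) hπ
  exact h.1.trans_lt (h.2.trans_lt hδ)

/-! ## §4 The pinning for the competitor (and the background) under (n3)'s binders -/

/-- ★★ **PINNING FOR THE COMPETITOR AT THE d = 3 CARRIER UNDER (n3)'S BINDERS**: for every `i ≤ K − n` and every level-`i` bond, the unguarded iterate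
`emlIterU i W♭` of the competitor read in `M₂(ℂ)ˣ` IS the family's `i`-fold (0.4)-descent `W̄^{(i)}` as matrices (✓ `Prop8Chart.coe_emlIterU_unitsField` ∘ §3).
[cite: Balaban1987RG1, (0.4) and (0.11) p.253; Balaban1985Variational, (156) p.302] -/
theorem coe_emlIterU_unitsField_competitor_T3 (F : T3Family) (n K : ℕ)
    (U₀ W : GaugeField (F.P K) 0 (Matrix.specialUnitaryGroup (Fin 2) ℂ)) {ε : ℝ} (hε : 0 < ε) (hεL : 1000000 * (F.L : ℝ) ^ 5 * ε ≤ 1)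
    (hU : ∀ p : Plaq (F.P K) 0, dist1 (GaugeField.plaqHol U₀ p) ≤ ε * (((F.L : ℝ) ^ (K - n)) ^ 2)⁻¹)
    (μ : ℕ → ℝ) (hμ0 : ∀ j < K - n, 0 ≤ μ j)
    (hμ : ∀ j < K - n, ∀ c : PBond (F.P K) (j + 1), ((((F.P K).d + 2) * (F.P K).L : ℕ) : ℝ) * ∑ b ∈ (univ.filter (fun b : PBond (F.P K) j => blockOf b.src = c.src ∨ blockOf b.src = c.tgt)), ‖(pertVar (Averaging.iter (fun i => blockAvg (P := (F.P K)) (j := i) (expMeanLogSU (n := Fin 2))) j U₀) (Averaging.iter (fun i => blockAvg (P := (F.P K)) (j := i) (expMeanLogSU (n := Fin 2))) j W)) b‖ ≤ μ j)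
    (hμ72 : ∀ j < K - n, 72 * μ j ≤ 1) (hμN : ∀ j < K - n, 3 * μ j + 1 / 24 < deltaSU (Fin 2)) :
    ∀ i, i ≤ K - n → ∀ b : PBond (F.P K) i,
      ((emlIterU i (unitsField (toUField W)) b : (Matrix (Fin 2) (Fin 2) ℂ)ˣ) : Matrix (Fin 2) (Fin 2) ℂ) =
        ((Averaging.iter (fun j => blockAvg (P := F.P K) (j := j) (expMeanLogSU (n := Fin 2))) i W b : Matrix.specialUnitaryGroup (Fin 2) ℂ) :
          Matrix (Fin 2) (Fin 2) ℂ) :=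
  coe_emlIterU_unitsField W (K - n) (small_iter_competitor_T3 F n K U₀ W hε hεL hU μ hμ0 hμ hμ72 hμN)

/-- **PINNING FOR THE BACKGROUND UNDER THE SAME (n3) BINDERS** (twin of ✓ `Prop8ChartAllL.coe_emlIterU_unitsField_T3_allL` in (n3)'s smallness currency).
[cite: Balaban1987RG1, (0.4) and (0.11) p.253; Balaban1985Variational, (156) p.302] -/
theorem coe_emlIterU_unitsField_background_T3' (F : T3Family) (n K : ℕ)
    (U₀ : GaugeField (F.P K) 0 (Matrix.specialUnitaryGroup (Fin 2) ℂ)) {ε : ℝ} (hε : 0 < ε) (hεL : 1000000 * (F.L : ℝ) ^ 5 * ε ≤ 1)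
    (hU : ∀ p : Plaq (F.P K) 0, dist1 (GaugeField.plaqHol U₀ p) ≤ ε * (((F.L : ℝ) ^ (K - n)) ^ 2)⁻¹) :
    ∀ i, i ≤ K - n → ∀ b : PBond (F.P K) i,
      ((emlIterU i (unitsField (toUField U₀)) b : (Matrix (Fin 2) (Fin 2) ℂ)ˣ) : Matrix (Fin 2) (Fin 2) ℂ) =
        ((Averaging.iter (fun j => blockAvg (P := F.P K) (j := j) (expMeanLogSU (n := Fin 2))) i U₀ b : Matrix.specialUnitaryGroup (Fin 2) ℂ) :
          Matrix (Fin 2) (Fin 2) ℂ) :=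
  coe_emlIterU_unitsField U₀ (K - n) (small_iter_background_T3' F n K U₀ hε hεL hU)

end T3

end Summit.QuantumFields.YangMills.Theorems.Prop7CompetitorGuardOfLevelSups

end
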